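import Mathlib
import Summits.NavierStokesRegularity.NavierStokesRegularity.Theorems.EulerZoomLiouvillePowerGaugeEulerLiouvilleSelfSimilarPastSubExtremal
import HarnessLib

/-!
# Crux `EulerZoomLiouville.PowerGaugeEulerLiouville` (stmt-NavierStokesRegularity-19832), line `relative_equilibria` (ns-idea-11): R3a-ASM, step 0 —
# UNIFICATION OF THE CONSTANTS of the spiral dictionary (thresholds `L ≥ 2 − T₁` ↦ `L ≥ 1`, three constants ↦ one `c'` in the shapes (A₁)/(E₁)/(D₁))

Route №10 `EulerZoomLiouville` (NavierStokesRegularity), crux E; width seat ns-ezl-w1 g10 under the LEAD ns-typeII-p2 g17 (KEY R3a-ASM).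
The assembly `Spiral.exists_locData_of_pastSpiral` (= `Past.exists_locData_of_past` with the spiral bricks P2–P7) ends with a brick-independent
bookkeeping step — the second half of `Past.exists_locData_of_past` verbatim: inflate the three raw growth bounds from their natural threshold
`L ≥ 2 − T₁` to `L ≥ 1` (`Past.growth_ge_one_of_growth_ge`) and trade the three constants for ONE `c' : ℝ≥0` in the shapes of
`Sig.stub_spiralLocData` — (A₁) `c'·L^{1−2ρ}`, (E₁) `L^{1−ρ}·((1−ρ)/(2+ρ))·c'`, (D₁) `L^{2−2ρ}·((2−2ρ)/(2+ρ))·c'`.  This file isolates that step so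
that the assembly proper is a pure composition of the bricks the minute the last of them (P4 sfl-p1, P6 ezl-w2, P7 ezl-w3) lands:

* ★ `Spiral.locData_unify` — raw bounds with constants `CA, CE, CD < ∞` for `L ≥ 2 − T₁` (`T₁ ≤ 0`) + the remaining clauses (measurabilities, weak
  derivative, Poisson, radial local energy identity — passed through) ⇒ `∃ c'`, the nine clauses of the conclusion of `Sig.stub_spiralLocData`
  (with the line's `HasRadialGradient θ` unfolded as `∀ z, ∃ m, gradient θ z = m • z`, as in the LEAD's `Spiral.pastSpiral_trivial_of_locData_of_subExtremal`).

WHAT THIS IS NOT: not NS, not E, not a stub: bookkeeping for the assembly of a width sub-line; 19832 OPEN; no summit statement is proved by this file.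
[folklore]
-/

noncomputable section

-- flat `Theorems/<Route><Decl>…` files of one crux share the namespace of the crux (tree convention: `Summit.<S>.<S>.…`)
set_option linter.dupNamespace false

open MeasureTheory Set Filter Topology Metric Function TopologicalSpace
open scoped ENNReal NNReal RealInnerProductSpace ContDiff Laplacian InnerProductSpace

namespace Summit.NavierStokesRegularity.NavierStokesRegularity.Theorems.PowerGaugeEulerLiouville

open Literature.Analysis Literature.Analysis.FunctionSpaces Literature.Analysis.FluidPDE

namespace Spiral

/-- ★ **UNIFICATION OF THE CONSTANTS OF THE SPIRAL DICTIONARY** (brick-independent bookkeeping of R3a-ASM; the second half of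
`Past.exists_locData_of_past` verbatim).  Raw growth bounds (A₁)/(E₁)/(D₁) with finite constants `CA, CE, CD` for `L ≥ 2 − T₁` (`T₁ ≤ 0`, `0 < ρ ≤ ½`),
together with the measurabilities, the weak derivative, the weak pressure Poisson equation and the radial local energy identity (passed through), give
ONE constant `c' : ℝ≥0` and the nine clauses of the conclusion of `Sig.stub_spiralLocData` for `L ≥ 1`. [folklore] -/
theorem locData_unify {ρ : ℝ} (hρ : 0 < ρ) (hρh : ρ ≤ 1 / 2) {T₁ : ℝ} (hT₁ : T₁ ≤ 0)
    {V : EuclideanSpace ℝ (Fin 3) → EuclideanSpace ℝ (Fin 3)} {P : EuclideanSpace ℝ (Fin 3) → ℝ}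
    {G : EuclideanSpace ℝ (Fin 3) → EuclideanSpace ℝ (Fin 3) →L[ℝ] EuclideanSpace ℝ (Fin 3)}
    (hVm : AEStronglyMeasurable V volume) (hPm : AEStronglyMeasurable P volume) (hGm : AEStronglyMeasurable G volume)
    (hVG : HasWeakFDerivOn (⊤ : Opens (EuclideanSpace ℝ (Fin 3))) volume V G)
    {CA CE CD : ℝ≥0∞} (hCA : CA ≠ ⊤) (hCE : CE ≠ ⊤) (hCD : CD ≠ ⊤)
    (hA' : ∀ L : ℝ, 2 - T₁ ≤ L → ∫⁻ y in ball (0 : EuclideanSpace ℝ (Fin 3)) L, ‖V y‖ₑ ^ 2 ≤ CA * ENNReal.ofReal (L ^ (1 - 2 * ρ)))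
    (hE' : ∀ L : ℝ, 2 - T₁ ≤ L →
      ∫⁻ y in ball (0 : EuclideanSpace ℝ (Fin 3)) L, ENNReal.ofReal (frobeniusNormSq (G y)) ≤ CE * ENNReal.ofReal (L ^ (1 - ρ)))
    (hD' : ∀ L : ℝ, 2 - T₁ ≤ L →
      ∫⁻ y in ball (0 : EuclideanSpace ℝ (Fin 3)) L, ‖P y‖ₑ ^ (3 / 2 : ℝ) ≤ CD * ENNReal.ofReal (L ^ (2 - 2 * ρ)))
    (hPoisson : ∀ θ : EuclideanSpace ℝ (Fin 3) → ℝ, ContDiff ℝ (⊤ : ℕ∞) θ → HasCompactSupport θ →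
      ∫ y, P y * (Δ θ) y = -∫ y, fderiv ℝ (fderiv ℝ θ) y (V y) (V y))
    (hEE : ∀ θ : EuclideanSpace ℝ (Fin 3) → ℝ, IsTestFunctionOn (⊤ : Opens (EuclideanSpace ℝ (Fin 3))) θ →
      (∀ z : EuclideanSpace ℝ (Fin 3), ∃ m : ℝ, gradient θ z = m • z) →
      (2 - 5 * (1 / (2 + ρ))) * ∫ x, θ x * ‖V x‖ ^ 2 =
        (∫ x, (‖V x‖ ^ 2 + 2 * P x) * ⟪V x, gradient θ x⟫) +
          (1 / (2 + ρ)) * ∫ x, ‖V x‖ ^ 2 * ⟪x, gradient θ x⟫) :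
    ∃ c' : ℝ≥0,
      AEStronglyMeasurable V volume ∧ AEStronglyMeasurable P volume ∧ AEStronglyMeasurable G volume ∧
      HasWeakFDerivOn (⊤ : Opens (EuclideanSpace ℝ (Fin 3))) volume V G ∧
      (∀ L : ℝ, 1 ≤ L → ∫⁻ y in ball (0 : EuclideanSpace ℝ (Fin 3)) L, ‖V y‖ₑ ^ 2 ≤
        (c' : ℝ≥0∞) * ENNReal.ofReal (L ^ (1 - 2 * ρ))) ∧
      (∀ L : ℝ, 1 ≤ L →
        ∫⁻ y in ball (0 : EuclideanSpace ℝ (Fin 3)) L, ENNReal.ofReal (frobeniusNormSq (G y)) ≤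
          ENNReal.ofReal (L ^ (1 - ρ)) * (ENNReal.ofReal ((1 - ρ) / (2 + ρ)) * (c' : ℝ≥0∞))) ∧
      (∀ L : ℝ, 1 ≤ L →
        ∫⁻ y in ball (0 : EuclideanSpace ℝ (Fin 3)) L, ‖P y‖ₑ ^ (3 / 2 : ℝ) ≤
          ENNReal.ofReal (L ^ (2 - 2 * ρ)) * (ENNReal.ofReal ((2 - 2 * ρ) / (2 + ρ)) * (c' : ℝ≥0∞))) ∧
      (∀ θ : EuclideanSpace ℝ (Fin 3) → ℝ, ContDiff ℝ (⊤ : ℕ∞) θ → HasCompactSupport θ →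
        ∫ y, P y * (Δ θ) y = -∫ y, fderiv ℝ (fderiv ℝ θ) y (V y) (V y)) ∧
      (∀ θ : EuclideanSpace ℝ (Fin 3) → ℝ, IsTestFunctionOn (⊤ : Opens (EuclideanSpace ℝ (Fin 3))) θ →
        (∀ z : EuclideanSpace ℝ (Fin 3), ∃ m : ℝ, gradient θ z = m • z) →
        (2 - 5 * (1 / (2 + ρ))) * ∫ x, θ x * ‖V x‖ ^ 2 =
          (∫ x, (‖V x‖ ^ 2 + 2 * P x) * ⟪V x, gradient θ x⟫) +
            (1 / (2 + ρ)) * ∫ x, ‖V x‖ ^ 2 * ⟪x, gradient θ x⟫) := by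
  -- adapted VERBATIM from the second half of `Past.exists_locData_of_past` (…SelfSimilarPastSubExtremal)
  have hρ1 : ρ < 1 := by linarith
  have h2ρ : (0 : ℝ) < 2 + ρ := by linarith
  -- ### thresholds to `L ≥ 1`
  have hL₀ : (1 : ℝ) ≤ 2 - T₁ := by linarith
  have hA1 := Past.growth_ge_one_of_growth_ge hL₀ (by linarith : (0 : ℝ) ≤ 1 - 2 * ρ) hA'
  have hE1 := Past.growth_ge_one_of_growth_ge hL₀ (by linarith : (0 : ℝ) ≤ 1 - ρ) hE'
  have hD1 := Past.growth_ge_one_of_growth_ge hL₀ (by linarith : (0 : ℝ) ≤ 2 - 2 * ρ) hD'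
  -- ### one common constant in the shapes (A₁), (E₁), (D₁)
  set CA' : ℝ≥0∞ := CA * ENNReal.ofReal ((2 - T₁) ^ (1 - 2 * ρ)) with hCA'
  set CE' : ℝ≥0∞ := CE * ENNReal.ofReal ((2 - T₁) ^ (1 - ρ)) with hCE'
  set CD' : ℝ≥0∞ := CD * ENNReal.ofReal ((2 - T₁) ^ (2 - 2 * ρ)) with hCD'
  have hCA't : CA' ≠ ⊤ := ENNReal.mul_ne_top hCA ENNReal.ofReal_ne_top
  have hCE't : CE' ≠ ⊤ := ENNReal.mul_ne_top hCE ENNReal.ofReal_ne_top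
  have hCD't : CD' ≠ ⊤ := ENNReal.mul_ne_top hCD ENNReal.ofReal_ne_top
  set κE : ℝ := (1 - ρ) / (2 + ρ) with hκE
  set κD : ℝ := (2 - 2 * ρ) / (2 + ρ) with hκD
  have hκE0 : 0 < κE := by rw [hκE]; exact div_pos (by linarith) h2ρ
  have hκD0 : 0 < κD := by rw [hκD]; exact div_pos (by linarith) h2ρ
  set a : ℝ := CA'.toReal with ha
  set e : ℝ := CE'.toReal with he
  set d : ℝ := CD'.toReal with hd
  have ha0 : 0 ≤ a := ENNReal.toReal_nonneg
  have he0 : 0 ≤ e := ENNReal.toReal_nonneg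
  have hd0 : 0 ≤ d := ENNReal.toReal_nonneg
  set c₀ : ℝ := a + e / κE + d / κD with hc₀
  have hc₀0 : 0 ≤ c₀ := by positivity
  set c' : ℝ≥0 := c₀.toNNReal with hc'
  have hcc : (c' : ℝ≥0∞) = ENNReal.ofReal c₀ := rfl
  have haC : CA' = ENNReal.ofReal a := (ENNReal.ofReal_toReal hCA't).symm
  have heC : CE' = ENNReal.ofReal e := (ENNReal.ofReal_toReal hCE't).symm
  have hdC : CD' = ENNReal.ofReal d := (ENNReal.ofReal_toReal hCD't).symm
  have hAle : CA' ≤ (c' : ℝ≥0∞) := by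
    rw [haC, hcc]
    refine ENNReal.ofReal_le_ofReal ?_
    have : 0 ≤ e / κE + d / κD := by positivity
    rw [hc₀]; linarith
  have hEle : CE' ≤ ENNReal.ofReal κE * (c' : ℝ≥0∞) := by
    rw [heC, hcc, ← ENNReal.ofReal_mul hκE0.le]
    refine ENNReal.ofReal_le_ofReal ?_
    have h1 : κE * (e / κE) = e := mul_div_cancel₀ e hκE0.ne'
    have h2 : 0 ≤ κE * a + κE * (d / κD) := by positivity
    rw [hc₀]; nlinarith [h1, h2]
  have hDle : CD' ≤ ENNReal.ofReal κD * (c' : ℝ≥0∞) := by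
    rw [hdC, hcc, ← ENNReal.ofReal_mul hκD0.le]
    refine ENNReal.ofReal_le_ofReal ?_
    have h1 : κD * (d / κD) = d := mul_div_cancel₀ d hκD0.ne'
    have h2 : 0 ≤ κD * a + κD * (e / κE) := by positivity
    rw [hc₀]; nlinarith [h1, h2]
  refine ⟨c', hVm, hPm, hGm, hVG, fun L hL => (hA1 L hL).trans (mul_le_mul' hAle le_rfl),
    fun L hL => (hE1 L hL).trans ?_, fun L hL => (hD1 L hL).trans ?_, hPoisson, hEE⟩
  · rw [mul_comm]; exact mul_le_mul' le_rfl hEle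
  · rw [mul_comm]; exact mul_le_mul' le_rfl hDle

end Spiral

end Summit.NavierStokesRegularity.NavierStokesRegularity.Theorems.PowerGaugeEulerLiouville

end
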